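import Literature.NumberTheory.NumberFields.HilbertClassFieldOfCharacters
import Literature.NumberTheory.GaloisRepresentations.GlobalReciprocityCharacterFormProofs
import Literature.NumberTheory.Automorphic.ClassFieldCharacterFrobenius
import Mathlib.GroupTheory.Perm.Cycle.Type
import HarnessLib

/-!
# The class field of a ray class character: unramified off the modulus, splitting = kernel

Topic `NumberTheory/NumberFields` (class field theory). Theorem-only file (no definition, no named
fact), unconditional, companion of `HilbertClassFieldOfCharacters.lean` (the modulus-`1` case for
characters of `Cl(𝓞_K)`); same inputs, all PROVED in the tree: Artin reciprocity for characters in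
primitive form (`Automorphic.artinReciprocity_character_primitive_holds`), the existence theorem in
character form (`HeckeCharacter.exists_eq_charHecke_of_isFiniteOrder`), ray-class Hecke characters
(`HeckeCharacter.exists_of_isRayClassCharacter`), rigidity of Hecke characters, the Frobenius /
splitting dictionary of `FrobeniusDensityTheorem.lean`.

> Neukirch, *Algebraic Number Theory*, VI (7.1) (Artin reciprocity: `Cl_K^𝔪/H → G(L|K)`, `𝔭 ↦ φ_𝔭`),
> VI (6.6) ("`𝔭` is ramified in `L ⟺ 𝔭 ∣ 𝔣`"), VI (7.3) (decomposition law: for `𝔭 ∤ 𝔪` of order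
> `f` in `Cl^𝔪/H`, `𝔭` splits into primes of degree `f`; in particular `𝔭 ∈ H ⟺ 𝔭` splits
> completely); Bonn Lectures III (7.8) (existence theorem).

Main results, for a number field `K : Type`, a nonzero ideal `𝔣` and a ray class character
`ψ mod 𝔣` (`LFunctions.IsRayClassCharacter 𝔣 ψ`, values on primes):

* `exists_inflateCharacter_eq_injective` — every rank-one Artin representation `ρ` of `K` is
  `χ ∘ r_E` for the finite abelian `E = K̄^{ker ρ}` and an **injective** character `χ` of `Gal(E/K)`
  (the tree's `exists_inflateCharacter_eq`, with injectivity recorded);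
* `MonoidHom.eq_one_of_forall_galFrob` — a character of an abelian `Gal(E/K)` killing the Frobenius
  of all unramified primes outside a finite set is trivial (the Frobenii generate,
  `closure_frobenius_eq_top`);
* `exists_classField_of_isRayClassCharacter` — **the class field `E_ψ` of `ψ`**: a finite Galois
  `E ⊆ K̄` over `K` such that (i) `E` is unramified at every `v ∤ 𝔣`; (ii) a prime `v ∤ 𝔣` with
  `ψ(v) = 1` splits completely in `E` (`splitPrimes`); (iii) if `ψ^N = 1` on the primes `∤ 𝔣` then
  every element of `Gal(E/K)` has order dividing `N` — so `[E : K]` is odd for `N` odd; (iv) if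
  `ψ(v) ≠ 1` for some `v ∤ 𝔣` then `[E : K] ≥ 2`.  Construction: the Hecke character `ω` of `ψ`
  is `χ₀ ∘ ψ_{L|K}`; with `ρ = χ₀ ∘ r_L = χ ∘ r_E`, `χ` injective, `ω = ω_χ`; the primitive reciprocity
  character of `ρ` is `ω` (rigidity), so `ρ`, hence `E`, is unramified wherever `ω` is, i.e. off `𝔣`;
  and at `v ∤ 𝔣`, `ψ(v) = ω(ϖ_v) = χ(Frob_v)`, so `ψ(v) = 1 ⟺ Frob_v = 1 ⟺ v` splits completely.

Used (with `𝔣 = (2)`, `ψ` a character of `cl(ℤ[√-p])` pulled back to `K = ℚ(√-p)`) in the discharge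
of `Literature.Computability.Cryptography.Csidh.jmv_smallPrimesGenerate`.

## References

* J. Neukirch, *Algebraic Number Theory* (1999), Ch. VI §6 Cor. (6.6), §7 Thm. (7.1), (7.3).
  [NeukirchANT1999]
* J. Neukirch, *Class Field Theory — The Bonn Lectures* (2013), Part III Thm. (7.8). [Neukirch2013]
* J. Tate, *Global class field theory*, Ch. VII of Cassels–Fröhlich (1967), §5.1, §12.
  [CasselsFrohlichANT1967]
-/

noncomputable section

open NumberField IsDedekindDomain Filter Polynomial Field
open scoped nonZeroDivisors

namespace Literature.NumberTheory.NumberFields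

open Literature.NumberTheory.GaloisRepresentations Literature.NumberTheory.Automorphic
  Literature.NumberTheory.LFunctions

universe u

/-! ### Rank-one Artin representations are inflated from injective characters -/

/-- **Every rank-one Artin representation is inflated from an injective character**: for
`ρ : Γ_K → GL_1(ℂ)` the fixed field `E = K̄^{ker ρ}` is finite abelian over `K` and `ρ = χ ∘ r_E`
for an injective character `χ` of `Gal(E/K)` (Neukirch VII §10, proof of (10.6): "`ψ` is the
inflation of an injective character `χ` of `G(L_ψ|K)`"; the tree's `exists_inflateCharacter_eq`,
whose proof is repeated to record injectivity). [cite: NeukirchANT1999, Ch. VII §10 Thm. (10.6) (proof)] -/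
theorem exists_inflateCharacter_eq_injective {K : Type u} [Field K] [NumberField K]
    (ρ : FramedArtinRep K 1) :
    ∃ (E : IntermediateField K (AlgebraicClosure K)) (_ : FiniteDimensional K E)
      (_ : IsAbelianGalois K E) (χ : (E ≃ₐ[K] E) →* ℂˣ),
      inflateCharacter E χ = ρ ∧ Function.Injective χ := by
  classical
  set N : Subgroup (absoluteGaloisGroup K) := ρ.toMonoidHom.ker with hNdef
  have hker : IsOpen (N : Set (absoluteGaloisGroup K)) := FramedArtinRep.isOpen_ker_toMonoidHom ρ
  set L : IntermediateField K (AlgebraicClosure K) := IntermediateField.fixedField N with hLdef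
  have hLN : L.fixingSubgroup = N := fixingSubgroup_fixedField_of_isOpen N hker
  haveI : FiniteDimensional K L := finiteDimensional_fixedField_of_isOpen N hker
  haveI : IsGalois K L := by
    rw [← InfiniteGalois.normal_iff_isGalois, hLN, hNdef]
    exact MonoidHom.normal_ker _
  have hr : ∀ (γ : absoluteGaloisGroup K) (x : L),
      ((absRestrictNormalHom L γ x : L) : AlgebraicClosure K) = γ • (x : AlgebraicClosure K) :=
    fun γ x => AlgEquiv.restrictNormalHom_apply L _ x
  have hrker : ∀ γ : absoluteGaloisGroup K, absRestrictNormalHom L γ = 1 ↔ ρ γ = 1 := by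
    intro γ
    have key : absRestrictNormalHom L γ = 1 ↔
        γ ∈ (L.fixingSubgroup : Subgroup (absoluteGaloisGroup K)) := by
      rw [mem_fixingSubgroup_iff_forall_smul]
      constructor
      · intro h1 x
        rw [← hr γ x, h1, AlgEquiv.one_apply]
      · intro h1
        ext x
        rw [hr γ x, AlgEquiv.one_apply]
        exact h1 x
    rw [key, hLN]
    exact MonoidHom.mem_ker
  have hrsurj : Function.Surjective (absRestrictNormalHom L) := absRestrictNormalHom_surjective L
  set e : ℂˣ ≃ₜ* GL (Fin 1) ℂ := FramedRep.unitsContinuousMulEquivOfUnique (Fin 1) ℂ with hedef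
  set f : absoluteGaloisGroup K →* ℂˣ := e.symm.toMulEquiv.toMonoidHom.comp ρ.toMonoidHom
    with hfdef
  have hf : ∀ γ : absoluteGaloisGroup K, f γ = e.symm (ρ γ) := fun γ => rfl
  have hkerle : (absRestrictNormalHom L).ker ≤ f.ker := by
    intro γ hγ
    rw [MonoidHom.mem_ker] at hγ ⊢
    rw [hf, (hrker γ).mp hγ, map_one]
  set χ : (L ≃ₐ[K] L) →* ℂˣ := (absRestrictNormalHom L).liftOfSurjective hrsurj ⟨f, hkerle⟩
    with hχdef
  have hχr : ∀ γ : absoluteGaloisGroup K, χ (absRestrictNormalHom L γ) = f γ := fun γ =>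
    (absRestrictNormalHom L).liftOfRightInverse_comp_apply _ _ _ γ
  have heρ : ∀ γ : absoluteGaloisGroup K, e (f γ) = ρ γ := fun γ => by
    rw [hf]
    exact e.apply_symm_apply (ρ γ)
  have hχinj : Function.Injective χ := by
    rw [← MonoidHom.ker_eq_bot_iff, Subgroup.eq_bot_iff_forall]
    intro g hg
    obtain ⟨γ, rfl⟩ := hrsurj g
    rw [MonoidHom.mem_ker, hχr] at hg
    have h2 : ρ γ = 1 := by rw [← heρ γ, hg, map_one]
    exact (hrker γ).mpr h2
  haveI hab : IsAbelianGalois K L :=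
    { is_comm := ⟨fun s t => hχinj (by rw [map_mul, map_mul, mul_comm])⟩ }
  refine ⟨L, inferInstance, hab, χ, DFunLike.ext _ _ fun γ => ?_, hχinj⟩
  rw [inflateCharacter_apply, hχr]
  exact heρ γ

/-! ### Characters of `Gal(E/K)` are determined on the Frobenii -/

variable {K : Type} [Field K] [NumberField K]

/-- **A character of an abelian `Gal(E/K)` which kills the Frobenius of every prime of `K` unramified
in `E` outside a finite set `B` is trivial** (the Frobenii of those primes generate `Gal(E/K)`, tree
`closure_frobenius_eq_top`). [folklore] -/
theorem MonoidHom.eq_one_of_forall_galFrob (E : IntermediateField K (AlgebraicClosure K))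
    [FiniteDimensional K E] [NumberField E] [IsAbelianGalois K E] {M : Type*} [CommGroup M]
    (φ : (E ≃ₐ[K] E) →* M) {B : Set (HeightOneSpectrum (𝓞 K))} (hB : B.Finite)
    (h : ∀ v : HeightOneSpectrum (𝓞 K), v ∉ B → Algebra.IsUnramifiedIn (𝓞 E) v.asIdeal →
      φ (galFrob K E v) = 1) : φ = 1 := by
  have hcomm := commute_of_isAbelianGalois E
  set B' : Set (HeightOneSpectrum (𝓞 K)) :=
    B ∪ {q | ¬ Algebra.IsUnramifiedIn (𝓞 E) q.asIdeal} with hB'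
  have hB'fin : B'.Finite := hB.union (finite_setOf_not_isUnramifiedIn K E)
  have htop := closure_frobenius_eq_top (K := K) (N := E) hcomm hB'fin
  have hle : Subgroup.closure {φ' : E ≃ₐ[K] E | ∃ v : HeightOneSpectrum (𝓞 K), v ∉ B' ∧
      ∃ Q ∈ v.asIdeal.primesOver (𝓞 E), IsArithFrobAt (𝓞 K) φ' Q} ≤ φ.ker := by
    rw [Subgroup.closure_le]
    rintro φ' ⟨v, hvB, Q, hQ, hφ'⟩
    simp only [hB', Set.mem_union, Set.mem_setOf_eq, not_or, not_not] at hvB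
    rw [SetLike.mem_coe, MonoidHom.mem_ker, eq_galFrob hcomm hvB.2 hQ hφ']
    exact h v hvB.1 hvB.2
  rw [htop, top_le_iff] at hle
  ext g
  have : g ∈ φ.ker := by rw [hle]; exact Subgroup.mem_top g
  rw [MonoidHom.mem_ker] at this
  rw [this, MonoidHom.one_apply]

/-! ### The class field of a ray class character -/

/-- The primes containing a nonzero ideal are finite in number. [folklore] -/
theorem finite_setOf_le_asIdeal {𝔣 : Ideal (𝓞 K)} (h𝔣 : 𝔣 ≠ ⊥) :
    {v : HeightOneSpectrum (𝓞 K) | 𝔣 ≤ v.asIdeal}.Finite := by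
  refine (Ideal.finite_factors h𝔣).subset fun v hv => ?_
  exact Ideal.dvd_iff_le.mpr hv

/-- **The class field of a ray class character.**  Let `K` be a number field, `𝔣 ≠ 0` an ideal of
`𝓞 K` and `ψ` a ray class character `mod 𝔣` (values on the primes `∤ 𝔣`).  There is a finite
Galois (abelian) `E ⊆ K̄` over `K` such that:
(i) `E` is unramified at every prime `v ∤ 𝔣` (Neukirch VI (6.6): the conductor divides `𝔣`);
(ii) every `v ∤ 𝔣` with `ψ(v) = 1` splits completely in `E` (VI (7.3), decomposition law);
(iii) if `ψ(v)^N = 1` for all `v ∤ 𝔣` then `g^N = 1` for all `g ∈ Gal(E/K)`;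
(iv) if `ψ(v) ≠ 1` for some `v ∤ 𝔣` then `2 ≤ [E : K]`.
Proof from the tree's global class field theory: `ψ ↦ ω` (Hecke character of finite order,
unramified off `𝔣` with `ω(ϖ_v) = ψ(v)`), `ω = χ₀ ∘ ψ_{L|K}` (existence theorem in character form),
`χ₀ ∘ r_L = χ ∘ r_E` with `χ` injective and `ω = ω_χ`, primitive Artin reciprocity and rigidity give
"`E` ramified at `v ⟹ ω` ramified at `v ⟹ v ∣ 𝔣`", and `ψ(v) = ω(ϖ_v) = χ(Frob_v)` at `v ∤ 𝔣`.
[cite: NeukirchANT1999, Ch. VI §7 Thm. (7.1) and (7.3), §6 Cor. (6.6)] [cite: Neukirch2013, Part III Thm. (7.8)] -/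
theorem exists_classField_of_isRayClassCharacter {𝔣 : Ideal (𝓞 K)} (h𝔣 : 𝔣 ≠ ⊥)
    {ψ : HeightOneSpectrum (𝓞 K) → ℂ} (hray : IsRayClassCharacter 𝔣 ψ) :
    ∃ E : IntermediateField K (AlgebraicClosure K), FiniteDimensional K E ∧ IsGalois K E ∧
      (∀ v : HeightOneSpectrum (𝓞 K), ¬ 𝔣 ≤ v.asIdeal → Algebra.IsUnramifiedIn (𝓞 E) v.asIdeal) ∧
      (∀ v : HeightOneSpectrum (𝓞 K), ¬ 𝔣 ≤ v.asIdeal → ψ v = 1 → v ∈ splitPrimes K E) ∧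
      (∀ N : ℕ, (∀ v : HeightOneSpectrum (𝓞 K), ¬ 𝔣 ≤ v.asIdeal → ψ v ^ N = 1) →
        ∀ g : E ≃ₐ[K] E, g ^ N = 1) ∧
      ((∃ v : HeightOneSpectrum (𝓞 K), ¬ 𝔣 ≤ v.asIdeal ∧ ψ v ≠ 1) →
        2 ≤ Module.finrank K E) := by
  classical
  set hR := artinReciprocity_character_holds
  -- the Hecke character of `ψ`
  obtain ⟨ω, hωfin, hω⟩ := HeckeCharacter.exists_of_isRayClassCharacter h𝔣 hray
  -- `ω = χ₀ ∘ ψ_{L|K}`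
  obtain ⟨L, hLfd, hLab, χ₀, hωχ₀⟩ := HeckeCharacter.exists_eq_charHecke_of_isFiniteOrder ω hωfin
  haveI := hLfd
  haveI := hLab
  haveI : NumberField L := NumberField.of_module_finite K L
  -- `ρ = χ₀ ∘ r_L = χ ∘ r_E`, `χ` injective, `ω = ω_χ`
  set ρ : FramedArtinRep K 1 := inflateCharacter L χ₀ with hρdef
  obtain ⟨E, hEfd, hEab, χ, hχρ, hχinj⟩ := exists_inflateCharacter_eq_injective ρ
  haveI := hEfd
  haveI := hEab
  haveI : NumberField E := NumberField.of_module_finite K E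
  have hcommE : ∀ a b : E ≃ₐ[K] E, Commute a b := commute_of_isAbelianGalois E
  have hωχ : ω = charHecke E χ hR := by
    rw [hωχ₀]
    show heckeOfArtinCharacter hR (inflateCharacter L χ₀) = heckeOfArtinCharacter hR (inflateCharacter E χ)
    rw [hχρ]
  -- `ρ` is unramified wherever `ω` is: primitive reciprocity character of `ρ` is `ω`
  have hρunr : ∀ v : HeightOneSpectrum (𝓞 K), ω.IsUnramifiedAt v → ρ.IsUnramifiedAt v := by
    obtain ⟨ω', -, hω'⟩ := artinReciprocity_character_primitive_holds (K := K) ρ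
    have heq : ω' = ω := by
      apply HeckeCharacter.ext_of_eventually_valueAtUniformizer_eq
      have hunrE : ∀ᶠ v : HeightOneSpectrum (𝓞 K) in cofinite,
          Algebra.IsUnramifiedIn (𝓞 E) v.asIdeal :=
        Filter.eventually_cofinite.mpr (finite_setOf_not_isUnramifiedIn K E)
      filter_upwards [hunrE] with v hunr
      have hρv : ρ.IsUnramifiedAt v := by
        rw [← hχρ]
        exact inflateCharacter_isUnramifiedAt E χ hunr
      obtain ⟨𝔓v, h𝔓v⟩ := v.primesAbove_nonempty
      obtain ⟨σ, hσ⟩ := HeightOneSpectrum.exists_isArithFrobAt_of_mem_primesAbove_holds h𝔓v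
      rw [(hω' v).2 hρv 𝔓v h𝔓v σ hσ, hωχ, charHecke_valueAtUniformizer E χ hR hunr]
      haveI : 𝔓v.IsPrime := h𝔓v.1
      have hP := comap_ringOfIntegersToIntegralClosure_mem_primesOver_of_mem_primesAbove E h𝔓v
      have hrσ := isArithFrobAt_absRestrictNormalHom E hσ
      have hfrob : absRestrictNormalHom E σ = galFrob K E v := eq_galFrob hcommE hunr hP hrσ
      rw [FramedRep.det_apply, Matrix.GeneralLinearGroup.val_det_apply, Matrix.det_fin_one, ← hχρ,
        inflateCharacter_apply_coe, hfrob]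
    intro v hv
    have h := (hω' v).1
    rw [heq] at h
    exact h.mp hv
  -- (i) `E` is unramified off `𝔣`
  have hunrE : ∀ v : HeightOneSpectrum (𝓞 K), ¬ 𝔣 ≤ v.asIdeal →
      Algebra.IsUnramifiedIn (𝓞 E) v.asIdeal := by
    intro v hv
    by_contra hram
    obtain ⟨𝔓, h𝔓, g, hg, hne⟩ := exists_mem_inertia_absRestrictNormalHom_ne_one (L := E) hram
    apply hne
    have h1 : ρ g = 1 := hρunr v (hω v hv).1 𝔓 h𝔓 g hg
    rw [← hχρ, inflateCharacter_apply] at h1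
    have h2 : χ (absRestrictNormalHom E g) = 1 :=
      (FramedRep.unitsContinuousMulEquivOfUnique (Fin 1) ℂ).injective (by rw [h1, map_one])
    exact hχinj (by rw [h2, map_one])
  -- `ψ(v) = χ(Frob_v)` at `v ∤ 𝔣`
  have hval : ∀ v : HeightOneSpectrum (𝓞 K), ¬ 𝔣 ≤ v.asIdeal →
      ψ v = ((χ (galFrob K E v) : ℂˣ) : ℂ) := by
    intro v hv
    rw [← (hω v hv).2, hωχ, charHecke_valueAtUniformizer E χ hR (hunrE v hv)]
  refine ⟨E, inferInstance, inferInstance, hunrE, ?_, ?_, ?_⟩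
  · -- (ii) splitting
    intro v hv h1
    have hfrob : galFrob K E v = 1 := by
      apply hχinj
      rw [map_one]
      exact Units.val_injective (by rw [← hval v hv, h1, Units.val_one])
    haveI : IsGaloisGroup (E ≃ₐ[K] E) (𝓞 K) (𝓞 E) := IsGaloisGroup.of_isFractionRing _ _ _ K E
    have hfIn : v.asIdeal.inertiaDegIn (𝓞 E) = 1 := inertiaDegIn_eq_one_of_galFrob_eq_one hfrob
    haveI := v.isMaximal
    obtain ⟨Q, hQmax, hQover⟩ :=
      Ideal.exists_maximal_ideal_liesOver_of_isIntegral (S := 𝓞 E) v.asIdeal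
    haveI := hQmax.isPrime
    haveI := hQover
    have hQ : Q ∈ v.asIdeal.primesOver (𝓞 E) := ⟨hQmax.isPrime, hQover⟩
    have hf : Q.inertiaDeg (𝓞 K) = 1 := by
      rw [← Ideal.inertiaDegIn_eq_inertiaDeg v.asIdeal Q (E ≃ₐ[K] E)]
      exact hfIn
    exact mem_splitPrimes_of_inertiaDeg_eq_one (hunrE v hv) hQ hf
  · -- (iii) exponent
    intro N hN g
    have hχN : χ ^ N = 1 := by
      refine MonoidHom.eq_one_of_forall_galFrob E (χ ^ N) (finite_setOf_le_asIdeal h𝔣) ?_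
      intro v hv _
      rw [Set.mem_setOf_eq] at hv
      rw [MonoidHom.pow_apply]
      apply Units.val_injective
      rw [Units.val_pow_eq_pow_val, ← hval v hv, hN v hv, Units.val_one]
    apply hχinj
    rw [map_pow, ← MonoidHom.pow_apply, hχN, MonoidHom.one_apply, map_one]
  · -- (iv) nontrivial
    rintro ⟨v, hv, hne⟩
    have hg : galFrob K E v ≠ 1 := by
      intro h1
      apply hne
      rw [hval v hv, h1, map_one, Units.val_one]
    rw [← IsGalois.card_aut_eq_finrank]
    by_contra hlt
    push Not at hlt
    haveI : Finite (E ≃ₐ[K] E) := inferInstance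
    have hcard : Nat.card (E ≃ₐ[K] E) = 1 := by
      have hpos : 0 < Nat.card (E ≃ₐ[K] E) := Nat.card_pos
      omega
    haveI : Subsingleton (E ≃ₐ[K] E) := (Nat.card_eq_one_iff_unique.mp hcard).1
    exact hg (Subsingleton.elim _ _)

omit [NumberField K] in
/-- **Odd exponent gives odd degree**: if every element of the (finite) Galois group has order
dividing an odd `N`, then `[E : K]` is odd (Cauchy). [folklore] -/
theorem odd_finrank_of_forall_pow_eq_one (E : IntermediateField K (AlgebraicClosure K))
    [FiniteDimensional K E] [IsGalois K E] {N : ℕ} (hN : Odd N)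
    (h : ∀ g : E ≃ₐ[K] E, g ^ N = 1) : Odd (Module.finrank K E) := by
  rw [← IsGalois.card_aut_eq_finrank]
  by_contra hodd
  rw [Nat.not_odd_iff_even, even_iff_two_dvd] at hodd
  haveI : Fact (Nat.Prime 2) := ⟨Nat.prime_two⟩
  obtain ⟨g, hg⟩ := exists_prime_orderOf_dvd_card' 2 hodd
  have h2N : 2 ∣ N := by
    rw [← hg]
    exact orderOf_dvd_of_pow_eq_one (h g)
  exact (Nat.not_even_iff_odd.2 hN) (even_iff_two_dvd.2 h2N)

end Literature.NumberTheory.NumberFields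

end
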